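import Summits.BirchSwinnertonDyer.BirchSwinnertonDyer.Theorems.EisensteinPrimesGoodLatticeBDPValueOfNamedFactsV34
import HarnessLib

/-!
# Crux `GoodLatticeBDPValue` (stmt-BirchSwinnertonDyer-19032) — line `halves` (skeleton v34N)

v34N (width seat bsd-line-x1-p1-w2 gen 27, 2026-08-30; ONE registry touch AUTHORISED by director-bsd g21 (483) with host bsd-eis RULING L122; token-identical
to v33N except the THREE edits below): **THE LAST PREPRINT-GRADE NAME LEAVES THE BY-NAME SURFACE — content stub 3a-A is DISCHARGED IN THE KERNEL
modulo two PUBLISHED named facts; the line has NO content stub left (preprint-grade 1 → 0; research 5 → 7).**  Width seat -w2 gen 26 proved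
`GoodLatticeAnacongOfCGLSProofOfDatum.thm222_anacong_goodLattice_of_fullDescentDatum_of_proofThm221_of_thmI :
CastellaGrossiLeeSkinner2022.proofThm221_congruence_of_fullEisensteinDescent → Hida2010MuInvariant.thmI_mu_katzLFunction_eq_zero →
KellerYin2024.thm222_anacong_goodLattice_of_fullDescentDatum` (p761499 over p756752 p757455 p758134 p759625 p760387 p760751 p760843 p760894: the character Euler
elements, the (A′)-congruence consumer, ℚ→K placement, Kriz 2016 Def. 31 (1) at `ℓ ≠ p` (Mazur 1978 Prop. 6.3) and at `ℓ = p` (anomalous: `Ẽ[p] ⊆ Ẽ(𝔽_p)`),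
the placement dichotomy, the descent TYPE `(N₊, N₋, N₀)` with Kriz (2)–(5) from the datum, and the K/ℚ residual-pair bridge `ResidualLineRigidity.residualPair_eq_restrictField`),
where `proofThm221_congruence_of_fullEisensteinDescent` (Literature p759553, ACCEPTED BY REVIEW against arXiv:2008.02571v2) is CGLS 2022 (Invent. Math. 227)'s PROOF of
Thm. 2.2.1 from the Eisenstein congruence (eq:cong-mf), entered through Kriz 2016 Def. 31 / Rem. 32 full descent — WEAKER than print by design — and
`thmI_mu_katzLFunction_eq_zero` is Hida 2010 (Ann. of Math. 172) Thm. I; and width seat -w2 gen 27 landed the by-name closure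
`GoodLatticeBDPValueOfNamedFactsV34.goodLatticeBDPValue_of_namedFacts₃₄ : ⟨v33N stub_printInputs⟩ → proofThm221_… → thmI_… → Theses.EisensteinPrimes.GoodLatticeBDPValue`
(p763736; = `…V33N.goodLatticeBDPValue_of_namedFacts₃₃ₙ` fed p761499; siblings `thm308_imc2_bdpValue_goodLattice_OPEN_of_namedFacts₃₄` on the crux's Literature `Prop`,
`goodLatticeBDPValue_of_printInputs₇` one-call form, `thm222_anacong_goodLattice_OPEN_of_proofThm221_of_thmI` = KY Thm. 2.2.2 every odd `p` BY NAME from the two names).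
EDITS vs v33N: (1) NEW cite stub `stub_descentInputs : proofThm221_congruence_of_fullEisensteinDescent ∧ thmI_mu_katzLFunction_eq_zero` [CITE-ONLY — never a proof target,
never benched] (two PUBLISHED Literature decls; kept as a SECOND cite stub rather than merged into `stub_printInputs`, so that `stub_printInputs` stays TOKEN-IDENTICAL to its
v33N registered text and the skeleton keeps two registered stubs — host L122 (5)); (2) `stub_anacongOfFullDescentDatum` (3a-A) is DELETED from the skeleton and leaves the
registry — it is the tree theorem p761499 fed `stub_descentInputs`; (3) the composition `GoodLatticeBDPValue_of` is ONE call
`GoodLatticeBDPValueOfNamedFactsV34.goodLatticeBDPValue_of_namedFacts₃₄ stub_printInputs stub_descentInputs.1 stub_descentInputs.2`.  `stub_printInputs` and everything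
else TOKEN-IDENTICAL to v33N (the `open` line gains `Hida2010MuInvariant`; the imports are `…OfNamedFactsV34` + HarnessLib).  STUBS: 2 (both CITE-ONLY), NONE kernel, NONE content;
sorries = stubs = 2.  BY-NAME SURFACE: **7 = research 7 (CGLS 2022 proof-of-4.2.2 / 5.1.3 (disc) / 2.1.2 / proof-of-2.2.1; Bleher et al. 2020 3.3.1; de Shalit 1987 II.6.4;
Hida 2010 Thm. I) · preprint-grade 0 · textbook 0** — no statement of the preprint arXiv:2402.12781 is read by the line: its Thm. 2.2.2 (`thm222_…_OPEN` /
`_of_fullDescentDatum` / `_of_five_le` / `_of_ne_one`) and, modulo the seven names, its Thm. 3.0.8 (`thm308_…_OPEN` = this crux) are kernel OUTPUTS.  PARTITION (D-0054):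
0 cells / 0 labels / 0 tiers move; row A1 stays OPEN-modulo-{PUB ×7}; no summit statement, no BSD / Mazur MC / IMC2 / KY 2.2.2 / theorem of CGLS, Hida, Kriz, Rubin
or de Shalit is proved for any curve; what the cell proved in the kernel is the REDUCTION of the crux to those seven published statements.  The v33N description follows.

v33N (LEAD bsd-line-x1-p1 g11, 2026-08-29; ONE registry touch per host RULING L119 (a) / director-bsd (390)(2), THREE moves):
**(1) MILNE ADT I THM. 4.10 (a) (RESTRICTED Ш-DUALITY, NATURAL FORM, AT THE FINITE SETS OF PLACES OF TOTALLY COMPLEX FIELDS) LEAVES THE BY-NAME SURFACE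
(textbook 1 → 0).** Conjunct 1 of v32's `stub_publishedFactsMore`, `∀ (L : Type) [Field L] [NumberField L] [IsTotallyComplex L] (S : Set (HeightOneSpectrum (𝓞 L))),
S.Finite → Literature.NumberTheory.GaloisCohomology.poitouTate_shaRestricted_tateDual_natural_at L S`, is the TREE THEOREM
`Summit.BirchSwinnertonDyer.BirchSwinnertonDyer.Theorems.PoitouTateShaNaturalAtTC.forall_poitouTate_shaRestricted_tateDual_natural_at_of_isTotallyComplex`
(`Theorems/EisensteinPrimesPoitouTateShaNaturalAtTC.lean`; LEAD RULING #9 = the type, RULING #10 = the Summits-side home — the all-places reciprocity law behind (R4) lives under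
`Summits/…/Theorems`), proved by the background lane «PT-Ш-S-TC» of cell bsd-eis (owner LEAD; width seats w2–w8, 2026-08-29): the `Ext`-road kit
`ShaExtRoadKit.natural_at_of_kit'` over the tree's `S`-idèle class formation `IdeleClassBar.truncSeqS` and invariant map `invS`, Tate–Nakayama duality `hα_classBarSD`,
`Ψ(E) = Ш²`, the layer bridge `natLayerS`, the `S`-idèle readouts `readoutSExtB` with (R3) and the reciprocity law (R4) `PoitouTateReciprocityS.read_idelePart_eq_sum`,
and Milne I Lemma 4.13 at `r = 2` ([P2-mono] `IdeleReadout.p2mono`: permutation dévissage, local layer/completion dictionary, Tate C–F VII §7.3 at finite level),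
assembled by `PoitouTateShaNaturalAtOfP2mono.forall_natural_at_of_P2mono`.
**(2) GREENBERG 2016 PROP. 4.1.1 LEAVES THE BY-NAME SURFACE (research 6 → 5)** (director-bsd g19 2026-08-29 (3); typed by width seat w5 gen 12, inputs by cruxlead-20395 g7 of
cell pub/bsd-wall): the line read `prop411_selmer_isAlmostDivisible` at ONE instance — case (c), `K` totally complex, the `H²(K_Σ/K, 𝐃)`-input from [Gr5] 3.2.1 (c) —
which follows from the SAME Poitou–Tate theorem (`Greenberg2016.selmer_isAlmostDivisible_caseC_of_prop321_of_isCotorsion_H_two'` p728036 + `prop321_caseC_of_poitouTateAt`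
p728414 over this line's SUR-Λ p714471); the consumer road (γ) is re-typed token for token with the textbook clause in the slot of Prop. 4.1.1
(`Theorems/EisensteinPrimesTwistDeformationFullAtSelmerOfPoitouTateAt` p731265, `…GoodLatticeBDPValueOfKatzUnitOfPoitouTateAt` p731485) and the by-name closure
`GoodLatticeBDPValueOfNamedFactsV33P.goodLatticeBDPValue_of_namedFacts₃₃ₚ` (p732651: crux from v32's stubs 1, 3a-A, 4b with stub 4 ABSENT).
**(3) VARIANT-N RESTUB (director-bsd (390)(1)–(3)) AND THIN SKELETON.** The PRINT facts the line still reads are the conjuncts of ONE cite stub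
`stub_printInputs : (proofThm422_… ∧ thm513_…_disc ∧ thm331_rubin_… ∧ thmII64_…) ∧ thm212_exists_isKatzLFunction` [CITE-ONLY — never a proof target, never benched]
(FIVE Literature decls by name; v32's `stub_publishedFacts` + `stub_publishedFactsMore.2`); the only CONTENT stub is `stub_anacongOfFullDescentDatum` (3a-A, TOKEN-IDENTICAL
to v24–v32); and the composition `GoodLatticeBDPValue_of` is ONE call to the kernel-checked by-name closure
`GoodLatticeBDPValueOfNamedFactsV33P.goodLatticeBDPValue_of_namedFacts₃₃ₚ` fed the Poitou–Tate THEOREM (= the body of the closure of record `…OfNamedFactsV33N.goodLatticeBDPValue_of_namedFacts₃₃ₙ`, LEAD g11) — the glue that v14–v32 carried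
inside the skeleton (`indexPlumbingLE`, `imprimLambdaLE_of_index`, `anThree_of_split`, `anQ_of_pieces`, `thm222_OPEN_of_slices`, `publishedFactsGreenberg_v29`,
`prop263_caseC_tc_v32`) has lived in LANDED Theorems files since v28/v32/V33P (`…OfNamedFactsV28` `imprimLambdaLE_of_facts_ofSurC`, `…AnThreeBookkeeping`,
`…OfNamedFactsSix.anQ_of_thm222_OPEN`, `…KatzUnitSuppliers`, `…OfKatzUnitOfPoitouTateAt`, `SurLambda…OfPoitouTateNaturalAt`), so it is no longer duplicated here.
STUBS: 2 (1 cite + 1 content), NONE kernel; sorries = stubs.  BY-NAME SURFACE: **6 = research 5 (CGLS 2022 proof-of-4.2.2 / 5.1.3 (disc) / 2.1.2; Bleher et al. 2020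
3.3.1; de Shalit 1987 II.6.4) · preprint-grade 1 (`KellerYin2024.thm222_anacong_goodLattice_of_fullDescentDatum`) · textbook 0**.  Tokens of record: PURE-CITE ×1 (merged),
CONTENT ×1.  PARTITION (D-0054): 0 cells / 0 labels / 0 tiers move; row A1 stays OPEN-modulo-{PUB ×5 ∧ preprint-grade 3a-A}; no summit statement, no BSD / Mazur MC /
IMC2 / KY 2.2.2 is proved for any curve; what the lane proved in the kernel is Milne I 4.10 (a) (finite `S`, totally complex `K`) in the tree's formulation, nothing more.
The descriptions of v32 … v14 follow (history of the line; the glue they mention now lives in the Theorems files named above).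

v32 (LEAD bsd-line-x1-p1 g10): **THE TEXTBOOK CONJUNCT IS NARROWED TO THE INSTANCE THE LINE READS — `stub_publishedFactsMore` conjunct 1 :=
`∀ (L : Type) [Field L] [NumberField L] [IsTotallyComplex L] (S : Set (IsDedekindDomain.HeightOneSpectrum (𝓞 L))), S.Finite → Literature.NumberTheory.GaloisCohomology.poitouTate_shaRestricted_tateDual_natural_at L S`**
(Milne ADT I Thm. 4.10 (a), restricted Ш-duality natural in the module, AT ONE FINITE SET OF PLACES of a totally complex field: the pointwise form
`GaloisCohomology.poitouTate_shaRestricted_tateDual_natural_at K S := ∃ B, (P) ∧ (N)` — the body of v31's named fact AT `S`, token for token, Literature p708774 —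
because road «SUR-Λ» reads the duality at ONE finite `Σ ⊇ S_p` only (`prop263_sur_of_crk_caseC_tc` binds `(S : Set _), S.Finite →`; C7b-6 began `obtain ⟨B, hP, hN⟩ := hX S`),
whereas v31's conjunct quantified over EVERY set of places, infinite ones included, which no consumer reads and which the background lane «PT-Ш-S-TC»
(finite-`S` engine on `IdeleClassBar.classBarSD K (S : Finset _)`) will not prove. The glue derives `prop263_sur_of_crk_caseC_tc` by LEAD g10's re-typed END-COMPOSE
`Summit.BirchSwinnertonDyer.BirchSwinnertonDyer.Theorems.SurLambda.prop263_sur_of_crk_caseC_tc_of_poitouTateNaturalAt` (over `Greenberg2016.dualSha_torsion_of_poitouTateAt`, the re-typed C7b-6) inside `prop263_caseC_tc_v32`.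
Everything else TOKEN-IDENTICAL to v31. BY-NAME SURFACE: 8 = research 6 · preprint-grade 1 · textbook 1 (the same Milne I 4.10 (a), now at the instances read); the lane's
END theorem `∀ K [IsTotallyComplex K] S, S.Finite → …_natural_at K S` discharges it (v33: `stub_publishedFactsMore := thm212` alone, 8 → 7). v31's description follows.

v31 (LEAD bsd-line-x1-p1 g9): **GREENBERG 2016 PROP. 2.6.3 LEAVES THE BY-NAME SURFACE (research 7 → 6) — `stub_publishedFactsMore` conjunct 1 :=
the TEXTBOOK named fact `∀ (L : Type) [Field L] [NumberField L] [IsTotallyComplex L],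
      Literature.NumberTheory.GaloisCohomology.poitouTate_shaRestricted_tateDual_natural L`** (Milne ADT I Thm. 4.10 (a) for `G_S` with the naturality of its pairing — Poitou–Tate duality of the
restricted Ш-groups, director-bsd ruling (342) «D-ii»; typed by width seat w2 gen 11, p704443), because road «SUR-Λ» (router w5 g9; bricks by w2 g10–g11,
w4 g18–g19, w5 g9, w8 g11) PROVED `Summit.BirchSwinnertonDyer.BirchSwinnertonDyer.Theorems.SurLambda.prop263_sur_of_crk_caseC_tc_of_poitouTateNatural` : that fact ⟹ `Greenberg2016.prop263_sur_of_crk_caseC_tc` (Greenberg 2010 §§2–3 over the tree's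
Poitou–Tate at totally complex fields: Λ-adic Tate duals, Props. 2.1.1/2.3.2/3.1.1/3.2.1 (c), Ш¹(K,Σ,T*) Λ-torsion from LEO via the Ш-duality tower). The glue
derives `prop263_sur_of_crk_caseC_tc` inside (`prop263_caseC_tc_v32`) and feeds it where v30 read `stub_publishedFactsMore.1`. Everything else TOKEN-IDENTICAL
to v30. BY-NAME SURFACE: 8 = research 6 · preprint-grade 1 · textbook 1. v30's description follows.

v30 (LEAD bsd-line-x1-p1 g9, with v29 below): **GREENBERG 2016 PROP. 2.6.3 IS CARRIED ONLY IN THE CASE THE LINE READS — `stub_publishedFactsMore` conjunct 1 :=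
`Greenberg2016.prop263_sur_of_crk_caseC_tc`** (the registered binders of `prop263_sur_of_crk` verbatim with `[IsTotallyComplex K]` and hypothesis (c) only:
Greenberg 2016 Prop. 2.6.3 (c) / Greenberg 2010 Prop. 3.2.1 (c), Literature p696608; implied by the general fact, `prop263_sur_of_crk_caseC_tc_of_prop263`) —
because every live consumer (`…AcTwistDeformation{SUR,SURRank,CurveSUR}OfTateTC` leaves: `K` imaginary quadratic, `Λ = R = ℤ_p⟦T⟧`, cofree `𝐃`, `𝓛` full at the split
prime `𝔭`, hypothesis (c) at `η = 𝔭`) reads exactly that case; the consumers are RE-TYPED token for token as `…OfSurC` (width seat w5 gen 9, 13 files, names `<name>_ofSurC`)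
and the glue calls `indexInputs_of_textbook_ofSurC` / `prop125_residualPair_unrSelmer_corank_ge_of_facts_ofSurC`. COUNT-NEUTRAL (8 names: research 7 + preprint-grade 1) — its point
is that the END THEOREM of road «SUR-Λ» (w5 g9 memo `SUR-LAMBDA-ROAD-w5g9.md`: Greenberg 2010 §§2–3 over the tree's Poitou–Tate at totally complex fields, bricks A–C by
w2 g10 / w4 g18 / w8 g11, input D = sub-lane «PT-Ш-S-TC») is now the fixed Lean statement `prop263_sur_of_crk_caseC_tc`, whose proof discharges name #9 with no further
consumer work (8 → 7). Everything else TOKEN-IDENTICAL to v29. v29's description follows.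

v29 (successor of LEAD g8's v28 = c4b5fea819f9c3e6; kit `mk_v29.py`): **MILNE ADT I THM. 5.1 LEAVES THE BY-NAME SURFACE (9 → 8) —
`stub_publishedFactsGreenberg := prop411_selmer_isAlmostDivisible` ALONE.** Tate's global Euler–Poincaré characteristic at every totally complex number field is a
TREE THEOREM (lane TATE-EPC-TC, w5 g7 router, bricks B0–B9 by w2/w3/w4/w5/w6/w7/w8): `Literature.NumberTheory.GaloisCohomology.forall_tateGlobalEulerPoincareCharacteristic_of_isTotallyComplex`; the glue feeds it where v28 had stub 4 conjunct 2
(the line reads 5.1 only at the imaginary quadratic field after T28b). Everything else TOKEN-IDENTICAL to v28. Stubs (4, none kernel). Named facts BY NAME: **8**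
(research 7 + preprint-grade 1). v28's description follows.

v28 (LEAD bsd-line-x1-p1 g8, 2026-08-29; v27 = 611f98ae549681b2; a first v28 4bcc937a… restricting only conjunct 3 was announced 00:17Z and
WITHDRAWN UNREGISTERED at 00:35Z when lane TATE-EPC-TC opened): **HARARI 17.13 (a) LEAVES THE BY-NAME SURFACE (10 → 9) AND MILNE I 5.1 IS CONSUMED AT
TOTALLY COMPLEX FIELDS ONLY — `stub_publishedFactsGreenberg` 3 → 2 conjuncts: `prop411 ∧ (∀ L [IsTotallyComplex L], tateGlobalEulerPoincareCharacteristic L)`.**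
Poitou–Tate in degrees `≥ 3` at every totally complex number field is now a TREE THEOREM — width seat w8 gen 9's lane PT3-TC, (A5) p681302:
`Literature.NumberTheory.GaloisCohomology.forall_poitouTate_restricted_three_le_of_isTotallyComplex : ∀ L [IsTotallyComplex L], poitouTate_restricted_three_le L`
(class-formation road: `RestrictedRamificationPoitouTateThreeLeOfCdTwo` p675005, `CohomologicalDimensionOpenSubgroupCriterion` p675422,
`RestrictedRamificationCdTwoOfH3Mu` p675904, (A1)–(A5) with bricks by w5 g6, w4 g16, w6 g8, w7 g7–g8, w3 g13–g15, w2 g8) — and the line reads 17.13 (a)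
ONLY at totally complex fields once Greenberg 2006 Prop. 3.2 is read in degrees `≤ 2` (this seat's lane T28, below), so the glue feeds that theorem where
v27 had stub 4 conjunct 3. The remaining textbook conjunct, Milne I 5.1, is restricted to `[IsTotallyComplex L]` = EXACTLY the end-theorem shape of lane
TATE-EPC-TC (w5 gen 7, ORDER OF WORK v1 00:18Z, bricks B0–B8 w2/w3/w4/w6/w7/w8), so its landing is the next discharge (9 → 8) with no further LEAD act. WHY 17.13 (a) was quantified over every number
field in v23–v27: w2 gen 6's `publishedFactsGreenberg_of_textbook` derives Greenberg 2006 Prop. 3.2 (`prop32_cohomology_isCofinitelyGenerated`: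
cofinite generation of `Hⁱ(K_Σ/K, 𝒟)` for EVERY `i`, every field) from {Milne I 5.1, Harari 17.13 (a)}, Poitou–Tate being needed for the
finiteness of `Hⁱ(G_S, α)`, `i ≥ 3`, at fields with real places. LEAD g8's lane «T28 / TATE RE-PLUMB» (head-on): every `.global` read of
Prop. 3.2 on the line is in degree `i ≤ 2` (`AcTwistDeformationLEO` i = 2, `…GreenbergFullAtSqueeze` i = 1, `WeakLeopoldtAbove` i = 2; the
local clause is the unconditional `Greenberg2006.prop32_local_holds`), and the tree has the degree-truncated dévissage
`ContinuousRep.module_finite_characterModule_continuousCohomology_of_le`; so Prop. 3.2 AS CONSUMED follows from Milne I 5.1 at the field in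
hand (`Literature/…/GaloisCohomology/RestrictedRamificationFiniteCoefficientsLeTwoOfTate` p677318,
`Literature/…/Greenberg2006/CohomologyCofiniteGenerationLeTwoOfTate{,TC}` p677794 / p682273: reading lemmas `prop32_global_le_two_of_tate{,_tc}`), and
the theorems of the line that carried Prop. 3.2 by name were RE-TYPED token for token: 18 files `Theorems/…OfTateTC.lean` against
`∀ L [IsTotallyComplex L], tateGlobalEulerPoincareCharacteristic L` (an `[IsTotallyComplex K]` binder added to `AcTwistDeformation.leo_of_hasCorank_H2_zero`
and the `WeakLeopoldtAbove` theorems, supplied by every caller from `IsImaginaryQuadratic K` / `∀ w, w.IsComplex`), and the 4 files of the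
no-pseudo-null chain `Theorems/…OfTate.lean` with the hypothesis dropped outright (only the unconditional local clause was read); a first pass
`…OfTate` at every number field, p679035–p681107, is superseded for the other 18. The other reads of the two facts are at totally complex fields:
Greenberg 2006 Prop. 4.1 is TYPED totally imaginary (`Literature/…/Greenberg2006/GlobalEulerPoincareCorankOfTateTC` p677647:
`prop41_of_tate_of_poitouTate_three_le_of_isTotallyComplex`), `cd_p(G_{K,Σ}) ≤ 2`
and the `H²` bookkeeping of stub 2a-I at the imaginary quadratic `K` (`GoodLatticeBDPValuePublishedFactsOfTextbookTC.indexInputs_of_textbook_tc`).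
PARTITION (D-0054): 0 cells / 0 labels / 0 tiers move by v28; row A1 stays OPEN-modulo-PUB (9 names); no summit statement, no BSD /
Mazur MC / IMC2 / KY 2.2.2 is proved for any curve.
CHANGES vs v27: stub 4 conjunct 3 DISCHARGED (fed by `forall_poitouTate_restricted_three_le_of_isTotallyComplex`), conjunct 2 restricted to TC; `publishedFactsGreenberg_v22` (8 conjuncts) ↦ `publishedFactsGreenberg_v28` (7: Prop. 3.2 gone);
`indexPlumbingLE` antecedent 6 ↦ Milne I 5.1 at TC fields (vestigial either way); `imprimLambdaLE_of_index` and the composition call the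
`_ofTateTC` / `_ofTate` / `_tc` consumers. Everything else TOKEN-IDENTICAL (stubs 1, 3a-A, 4b; `anThree_of_split`, `thm222_OPEN_of_slices`, `anQ_of_pieces`). Stubs (4, NONE
kernel; sorries = stubs). Named facts BY NAME: 10 → **9** (research 7 + composed-print 1 + textbook 1: Milne I 5.1 at TC fields). By-name closure on this surface:
`Theorems/EisensteinPrimesGoodLatticeBDPValueOfNamedFactsV28` (LEAD g8). v27's description follows.

v27 (LEAD bsd-line-x1-p1 g7, 2026-08-28; SUPERSEDES the announced-but-unregistered v26 = c3a0f1a69bbad996, whose single move it contains; v25 = 6bcac25becd2ccd5): **THE `5 ≤ p` SLICE OF [AN] LEAVES THE BY-NAME SURFACE — `stub_publishedFactsMore` 3 → 2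
(`prop263 ∧ thm212`).** Width seats w7 gen 7 / w3 gen 13 / w6 gen 8 / w5 gen 6 (road R5 / AN-5) proved in the kernel, UNCONDITIONALLY, the
`5 ≤ p` twin T‴ of the closed stub 3a-B: for `5 ≤ p`, `Good W p`, `Red W p` and the good-lattice normalisation, `E` has an additive prime or a
multiplicative `ℓ` split with `ℓ ≡ 1 (mod p)` or non-split with `ℓ ≡ −1 (mod p)` (`GoodLatticeBDPValueFullDescentFiveLe.fullDescentDatum_of_five_le`:
Theorem A′ on `E[p²]` + Herbrand splitting + line characters at multiplicative places; Ribet–Yoo-type necessity), whence the bridge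
`GoodLatticeBDPValueFullDescentFiveLe.thm222_anacong_goodLattice_of_five_le_of_fullDescentDatum : thm222_anacong_goodLattice_of_fullDescentDatum → thm222_anacong_goodLattice_of_five_le`.
So the composed-print fact `KellerYin2024.thm222_anacong_goodLattice_of_five_le` (stub 4b conjunct 2 since v19) is DERIVED from stub 3a-A's
NAME and DROPPED; `thm222_OPEN_of_slices` is fed `(bridge stub_anacongOfFullDescentDatum)` in `anQ_of_pieces` and in the composition; `thm212`
moves to `.2`. Everything else TOKEN-IDENTICAL. Named facts of the line BY NAME: −1 (composed-print 2 → 1: only `_of_fullDescentDatum`,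
whose label is under referee C3 review, remains). v26's description follows.

v26 (LEAD bsd-line-x1-p1 g7, 2026-08-28; v25 = 6bcac25becd2ccd5): **THE FIRST BY-NAME INPUT OF THE LINE IS DISCHARGED IN THE KERNEL —
`stub_publishedFactsGreenberg` 4 → 3.** Iwasawa's cyclotomic weak Leopoldt `IwasawaTheory.weakLeopoldt_H2_subsingleton_cyclotomic_of_isOpen`
(NSW (10.3.25); stub 4 conjunct 2 since v24, = Greenberg's (T4) by w2 gen 7's p665558) is now a TREE THEOREM WITHOUT CLASS FIELD THEORY:
`GoodLatticeBDPValueStagesDie.weakLeopoldt_H2_subsingleton_cyclotomic_of_isOpen_holds` — the width seats' programme on crux 2 (w8 gen 8 radical descent p668396/p670271 «the Cl_S-term of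
NSW (8.3.11) at element level»; w3 gen 12 Kummer theory on closed subgroups of Γ_K p667914/p668651/p668961; w6 gen 7 inflation-kernel
cochain calculus p668586/p669096/p669960/p670373; w4 gen 15 profinite eventual-coboundary lemma p667805 + the «stagesDie» adapter; w2 gen 7/8
levels + assembly p668583/p669467 `weakLeopoldt_H2_subsingleton_cyclotomic_of_isOpen_of_stagesDie`; tree cyclotomic layer killing
`GaloisCohomology.exists_forall_resSub_mu_primePow_eq_zero_of_le_layerSubgroup`). So the conjunct LEAVES THE SKELETON: (T4) is re-derived
inside `publishedFactsGreenberg_v22` as the theorem `GoodLatticeBDPValueStagesDie.weakLeopoldt_H2_subsingleton_above_cyclotomic_of_isOpen_holds` (T4 UNCONDITIONAL, p672832), and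
`imprimLambdaLE_of_index` reads the two textbook conjuncts at `.2.1/.2.2`. Everything else TOKEN-IDENTICAL to v25. Stubs (4, NONE kernel;
sorries = stubs): `stub_publishedFacts` (4 PUB) · `stub_anacongOfFullDescentDatum` (1 composed-print NAME) · `stub_publishedFactsGreenberg`
(prop411 ∧ Milne I 5.1 ∧ Harari 17.13 (a)) · `stub_publishedFactsMore` (prop263 ∧ `_of_five_le` ∧ thm212). Named facts of the line BY NAME:
12 → **11** (research 7 + composed-print 2 + textbook 2); discharged in the kernel: 1 (cycWL ⟹ T4). By-name closure on this surface:
`Theorems/EisensteinPrimesGoodLatticeBDPValueOfNamedFactsV26` (LEAD g7). v25's description follows.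

v25 (LEAD bsd-line-x1-p1 g7, 2026-08-28; v24 = 42bc5cdf2809822b): **HIDA-BY-NAME IS RETIRED — `stub_publishedFacts` 5 → 4.** Width seat
w5 gen 5 showed in the kernel that the de-Shalit-frame typing of Hida 2010 Thm. I (`thmI_mu_katzBranch_reflect_eq_zero`, stub 1
conjunct 5 since v10) is consumed on the line EXACTLY ONCE — to get `g(S=0) mod p ≠ 0` in §5 of `goodLattice_jointMuLambda_of_facts` —
and that this non-vanishing follows from ANY `R₀`-valued CGLS Katz witness of `θ_K` on the anticyclotomic line carrying a unit
coefficient (`KatzLineReverseMuTransfer.map_residue_constantCoeff_ne_zero_of_isKatzLFunction`, p665992: utd-p1's μ-transfer run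
backwards on w4 gen 2's p-power rigidity), whence the Hida-free joint road `goodLattice_jointMuLambda_of_katzUnit` (p666612), the road
p667992 and the terminal consumer `GoodLatticeBDPValueOfKatzUnit.goodLatticeBDPValue_of_print_of_leTD_of_le_of_anQ_of_katzUnit` (= LEAD
g6's p662689 token for token with `hO1 ↦ hKatzUnitAll`). The unit-coefficient Katz witness is SUPPLIED BY INPUTS THE LINE ALREADY HAS:
`GoodLatticeBDPValueKatzUnitSuppliers.katzUnitAll_of_anacong (han : thm222_anacong_goodLattice_OPEN) (h212)` (p667318) — the μ-clause
`FirstUnitCoeffAt Lφ nφ` of [AN] at the restricted Teichmüller pair with the CGLS Thm. 2.1.2 witness —, and on this line [AN] at every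
odd `p` is `thm222_OPEN_of_slices ⟨stub 4b's _of_five_le⟩ anThree_of_split` (3a-A BY NAME at the datum of the closed 3a-B). So the
composition below feeds the consumer's μ-slot with that term and `thmI_…` LEAVES THE SKELETON: Hida's `μ = 0` is now used only through
the two composed-print [AN] facts, whose citations already carry it (CGLS L1132 «Hida's result»). Everything else TOKEN-IDENTICAL to v24
(`anQ_of_pieces` reads `thmII64` at its new position `.2.2.2`). Stubs (4, NONE kernel; sorries = stubs): `stub_publishedFacts` (4 PUB:
CGLS proof of 4.2.2, CGLS 5.1.3 (disc), Bleher et al. 3.3.1, de Shalit II.6.4) · `stub_anacongOfFullDescentDatum` (1 composed-print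
NAME) · `stub_publishedFactsGreenberg` (prop411 ∧ cycWL ∧ Milne I 5.1 ∧ Harari 17.13 (a)) · `stub_publishedFactsMore` (prop263 ∧
`_of_five_le` ∧ thm212). Named facts of the line BY NAME: 13 → **12** (research 7 + composed-print 2 + textbook 3). By-name closure on
this surface: `Theorems/EisensteinPrimesGoodLatticeBDPValueOfNamedFactsV25` (w5 gen 5 / LEAD g7). v24's description follows.

v24 (LEAD bsd-line-x1-p1 g7, 2026-08-28, RESHAPE #27; v23 = 9d825c144e719dbd): **EVERY STUB IS NOW A CONJUNCTION OF LITERATURE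
NAMES — THE LAST INLINE STATEMENT (3a-A) IS A NAMED FACT, AND (T4) IS STATED AS ITS TEXTBOOK CYCLOTOMIC CASE.** Two count-neutral,
faithfulness-raising moves, nothing else touched: (i) `stub_anacongOfFullDescentDatum` (3a-A: [AN] at every odd `p` GIVEN a
full-descent datum; v21–v23 carried its text inline) is RESTATED BY NAME as
`KellerYin2024.thm222_anacong_goodLattice_of_fullDescentDatum` (`Literature/NumberTheory/EllipticCurves/KellerYin2024/
AnomalousCongruenceFullDescentDatum.lean`, p666692, LEAD g7 — the registered v21–v23 text token for token, so `anThree_of_split`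
is unchanged (the `def` unfolds on application); composed of refereed print in the filer's reading: Kriz 2016 Thm. 3 under
Assumptions 1 (no `p > 3`), Def. 31 (5) (the factor `(1 − ψ₂(ℓ))`, `ℓ ∣ N₋N₀`, vanishes under the datum), Rem. 33, Thm. 34 (3)
(«N₋ any product of ℓ ∥ N with a_ℓ ≡ ψ₂(ℓ)ℓ»), Thm. 35 ∘ CGLS 2022 Thms. 2.2.1/2.2.2 ∘ Hida 2010 Thm. I — three LEAD page-checks
(g5 candidate, g6 `Lines/halves_3aA_pagecheck_leadg6.md`, g7 [corpus: paper:arxiv-1512.05032 p0008/p0020–p0022]); referee C3's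
ruling on the label is pending and governs any relabel); (ii) `stub_publishedFactsGreenberg`'s second conjunct (T4, Greenberg 2006
pp. 343–344 / NQD 1984 Thm. 2.2, open-subgroup form) ↦ Iwasawa's CYCLOTOMIC weak Leopoldt
`IwasawaTheory.weakLeopoldt_H2_subsingleton_cyclotomic_of_isOpen` (NSW (10.3.25) with (10.3.22); relocated fact p665557), which
width seat w2 gen 7 proved EQUIVALENT to (T4) in the kernel (`GoodLatticeBDPValueT4OfCyclotomic.above_cyclotomic_of_cyclotomic` /
`cyclotomic_of_above_cyclotomic`, p665558) — (T4) is re-derived inside `publishedFactsGreenberg_v22`; this is the exact target of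
width seat w8 gen 8's discharge lane. By-name closure on this surface: LEAD g7
`Theorems/EisensteinPrimesGoodLatticeBDPValueOfNamedFactsV24.goodLatticeBDPValue_of_namedFacts₂₄` (crux ⇐ THIRTEEN Literature
named facts, 0 inline statements). Stubs (4, NONE kernel; sorries = stubs): `stub_publishedFacts` (5 PUB) ·
`stub_anacongOfFullDescentDatum` (1 composed-print name) · `stub_publishedFactsGreenberg` (prop411 ∧ cycWL ∧ Milne I 5.1 ∧ Harari
17.13 (a)) · `stub_publishedFactsMore` (prop263 ∧ `_of_five_le` ∧ thm212). Named facts of the line BY NAME: 13 (research 8 +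
composed-print 2 + textbook 3). v23's description follows.

v23 (LEAD bsd-line-x1-p1 g6, 2026-08-28, RESHAPE #26; v22 = 873a80a39b833647): **THE BY-NAME PUBLISHED INPUT SHRINKS FROM 20 FACTS
TO 12; NOTHING PREPRINT MOVES; EVERY DROPPED FACT IS DERIVED IN THE KERNEL FROM THE KEPT ONES OR FROM UNCONDITIONAL TREE THEOREMS.**
Built on width seat w2 gen 6's option (c727875e…/8b2ffe90…) and the bricks of w3 gen 7, w4 gen 10, w5 gen 2, w6 gen 2, w7 gen 2:
(i) `stub_publishedFacts` 7 → 5: Castella–Hsieh 2018 existence is READ OFF the frame clause of the CGLS proof-of-Thm.-4.2.2 fact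
(w4 g10 `GoodLatticeThm308OfPrint.goodBDPExistsOnTree_of_proofThm422'`; w5 g2 `…H1OfCGLS`); Carayol «level = conductor» is IDLE —
the line needs `p ∤ N` and `Heeg(N) ↔ Heeg(N_E)` only, from the unconditional `IsNewformOf.dvd_level_iff_dvd_conductorNorm` (w3 g7
`GoodLatticeBDPValueHalvesNoCarayol`, p661564); CGLS Thm. 5.1.3 is cited in its print-faithful (disc) form
`thm513_exists_isBDPLFunction_valueAtOne_disc` (ARM-P flag CGLS22-Thm513-disc; w4 g10 `goodBDPValueOnTree_of_thm513disc'`); terminal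
consumer `GoodLatticeBDPValueStubOneOfPrint.goodLatticeBDPValue_of_print_of_leTD_of_le_of_anQ` (LEAD g6). (ii)
`stub_publishedFactsGreenberg` 8 → 4: Greenberg 2016 Prop. 4.2.2, Greenberg 2006 §5 A and Prop. 4.2 are TREE THEOREMS
(`prop422_…_holds`, `sec5A_…_holds`, `prop42_…_holds`); Greenberg 2006 Props. 3.2 / 4.1 follow from two TEXTBOOK named facts —
Tate's global Euler–Poincaré characteristic (Milne ADT I Thm. 5.1, `GaloisCohomology.tateGlobalEulerPoincareCharacteristic`) and
Poitou–Tate in degrees `≥ 3` (Harari Thm. 17.13 (a), `GaloisCohomology.poitouTate_restricted_three_le`) — (w2 g6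
`GoodLatticeBDPValuePublishedFactsOfTextbook`, p660402); BCGKPST 2020 §3.3 follows from stub 1's Thm. 3.3.1 (w6 g2
`GoodLatticeBDPValueSec33OfThm331.sec33_of_thm331`, p661944); the old eight-conjunct text is the DERIVED `publishedFactsGreenberg_v22`.
(iii) `stub_publishedFactCD2` DELETED: `cd_p(G_{K,Σ}) ≤ 2` is consumed at the imaginary quadratic `K` only, where it follows from
Poitou–Tate (p660402 §2; at every number field: w7 g2 `GaloisCohomology.…_of_poitouTate_three_le`, p661411). (iv)
`stub_publishedFactsMore` 4 → 3: `thm222_anacong_goodLattice_of_ne_one` is IDLE — at `p = 3` the join `anThree_of_split` (stub 3a-A at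
the full-descent datum of the CLOSED stub 3a-B, p658450) serves EVERY residual pair, the triviality binder having never been used, so
`thm222_OPEN_of_slices` has two slices (`5 ≤ p`, `p = 3`). (v) `stub_anacongOfFullDescentDatum` (3a-A) TOKEN-IDENTICAL (its label is
referee C3's question, pub/pub-bsdpct/INBOX.md 2026-08-28 l.904/l.911; candidate `Lines/halves_3aA_literature_candidate.lean`).
Stubs (4, NONE kernel): `stub_publishedFacts` (5 PUB: CGLS proof of 4.2.2, CGLS 5.1.3 (disc), Bleher et al. 3.3.1, de Shalit II.6.4,
Hida Thm. I) · `stub_anacongOfFullDescentDatum` (3a-A, PUB-composed candidate) · `stub_publishedFactsGreenberg` (Greenberg 2016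
4.1.1, T4, Milne I 5.1, Harari 17.13 (a)) · `stub_publishedFactsMore` (Greenberg 2016 2.6.3, `_of_five_le`, CGLS 2.1.2). Named facts
of the line BY NAME: 20 → 12 (research-paper 10 + textbook 2) ∧ 3a-A. v22's description follows.

v22 (LEAD bsd-line-x1-p1 g5, 2026-08-28; v21 = dadbf9cb1c618059): **STUB 3a-B `stub_fullDescentAtThreeOfRed` (Theorem T′) IS
CLOSED AND LEAVES THE SKELETON** — proved, its registered statement verbatim and UNCONDITIONALLY (no named fact), as
`GoodLatticeBDPValueFullDescentStub.stub_fullDescentAtThreeOfRed` (`Theorems/EisensteinPrimesGoodLatticeBDPValueFullDescentStub.lean`):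
the elementary Galois-module road inside `E[9]` (width seat w3 gen 4's memo `Lines/…` / `HOME/line-x1-p1-w3-g4/AN3-StubB-
elementary-road.md`; no Hecke algebras) — the LEAD's assembly `FullDescentAssembly.fullDescentAtThreeOfRed_of_pieces` (Lemma S′,
Theorem B, Theorem A + the local step L2) on the bricks of the width seats w2 gen 5 (Kummer splitting `exists_stable_complement`,
(G-ℚ) `monoidHom_eq_one_of_forall_greenbergInertia`, Lemma S′ `lemmaS_spec`, unipotent inertia, `fullDescentAtThreeOfRed_of_
theoremA`), w3 gen 4 (Tate bases at levels 3/9 and the algebra (T-a)–(T-f), ordinary lines, Frobenius end-game `9 ≤ 7`,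
Minkowski/Cassels), w4 gen 5/6 (Weil determinant and its converse, ordinary kernels at `3`, uniqueness of `K₉`), x2-p1-w7 (line
characters at multiplicative places), and the LEAD's Theorem B (`FullDescentTheoremB.exists_omega_point_of_fixed_point`) and
Theorem A (`FullDescentTheoremA.exists_stable_nine_of_omega_point`, `false_of_stable_nine`, `theoremA`). The join
`anThreeTrivial_of_split` now calls the landed theorem. **THE LINE IS KERNEL-COMPLETE MODULO PUBLISHED FACTS AND THE ONE
PREPRINT-COMPOSED RESIDUE 3a-A** (`stub_anacongOfFullDescentDatum`: CGLS 2.2.1/2.2.2 + Kriz 34/35 + Hida given the full-descent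
datum). Stubs (5): `stub_publishedFacts` (7 PUB) · `stub_anacongOfFullDescentDatum` (PRE, PUB-composed candidate) ·
`stub_publishedFactsGreenberg` (8 PUB) · `stub_publishedFactsMore` (4 PUB) · `stub_publishedFactCD2` (1 PUB). v21's description follows.

v21:

v21 (LEAD g4, same day; v20.3 = fe2d23d2f33fea42): **THE LAST PREPRINT STUB IS SPLIT** along idea-11 g9's typed AN-3 split
(`Lines/halves_anThree_typedSplit_idea11g9.lean` rev 1.2 def973ee4a2e, card rev 1.3; critic VERDICT #59 PASS, 0 strikes):
`stub_anThreeTrivial` (KY Thm. 2.2.2 at `p = 3`, `𝟙̃|_{G_K} = 𝟙`) ↦ `stub_anacongOfFullDescentDatum` (3a-A: [AN] given a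
full-descent datum, every odd `p` — CGLS Thm. 2.2.1/2.2.2 + Kriz Thm. 34/35 + Hida, register candidate PUB-composed) +
`stub_fullDescentAtThreeOfRed` (3a-B: Theorem T′ — `3 ∤ N`, `E[3]` reducible ⇒ a full-descent datum; KERNEL candidate) with the
sorry-free join `anThreeTrivial_of_split` (the old statement token for token) feeding `anQ_of_pieces`. Stubs (6):
`stub_publishedFacts` (7 PUB) · `stub_anacongOfFullDescentDatum` (PUB-composed candidate) · `stub_fullDescentAtThreeOfRed` (KERNEL
candidate) · `stub_publishedFactsGreenberg` (8 PUB) · `stub_publishedFactsMore` (4 PUB) · `stub_publishedFactCD2` (1 PUB).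

v20.3 (LEAD g4, same day; v20.2 = 2026857c759a9505): **`stub_indexInputs` IS CLOSED (AND LEAVES THE SKELETON)** — proved, its
registered statement verbatim, as `GoodLatticeBDPValueIndexStubs.indexInputs` (two lines: width seat w7's
`IndexInputsShell.indexInputs_of_H2` + width seat w4 gen 5's `IndexInputsH2.natCard_H2_conjunct`, on w5 (R), LEAD g3 Kummer, w4/w7
(U), w3 SUR ×3, w7/w6 `H⁰`, w2 gen 4 weak Leopoldt, w4 gen 3 DIV/LRS, w2 gen 3 FIN); the glue `imprimLambdaLE_of_index` calls it.
AND `stub_indexPlumbing` IS CLOSED TOO — width seat w8's `IndexPlumbingNrVsStrict.lambdaInvariant_add_le_of_mid` ((C) w5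
`IndexPlumbingDictionary`: Castella's `Sel_v̄^{Sf}` is `R(E[p^∞])` and `λ = corank`; (B2) strict = unramified for `ω̃`; (B1) the
unramified-vs-strict `≤ p^c` for `𝟙̃`), wrapped as `indexPlumbingLE`. **THE LINE IS KERNEL-COMPLETE MODULO PUBLISHED FACTS AND
THE ONE PREPRINT RESIDUE `stub_anThreeTrivial`** (KY Thm. 2.2.2 at `p = 3`, `𝟙̃|_{G_K} = 𝟙`). Stubs (5): `stub_publishedFacts`
(7 PUB) · `stub_anThreeTrivial` (PRE) · `stub_publishedFactsGreenberg` (8 PUB) · `stub_publishedFactsMore` (4 PUB) ·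
`stub_publishedFactCD2` (1 PUB).

v20.2 (LEAD g4, same day; v20.1 = 5ba462b78a02fa34): ONE PUBLISHED INPUT ADDED. The `H²`-bookkeeping conjunct of
`stub_indexInputs` needs `cd_p(G_{K,Σ}) ≤ 2` (NSW (8.3.18)), which is a Literature NAMED FACT
(`GaloisCohomology.groupCdLE_two_galoisGroupUnramifiedOutside`) and not among the Greenberg facts of stub 4: it becomes the 7th
stub `stub_publishedFactCD2` (PUB, by name) and the 10th leading antecedent of `stub_indexInputs` (supplied by the glue).
Everything else byte-identical to v20.1. Stubs (7 = stubs_max): publishedFacts · indexInputs · indexPlumbing · anThreeTrivial ·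
publishedFactsGreenberg · publishedFactsMore · publishedFactCD2.

v20.1 (LEAD g4, same day; v20 = a012386a25ed62cc): `stub_indexPlumbing`'s conclusion and the derived glue are WEAKENED from
the `λ`-IDENTITY to the INEQUALITY `λ(DSsub.X) + λ(DSquot.X) ≤ λ(𝔛^{Sf}_f) + [𝟙̃ = 𝟙]` — the only direction the composition
uses (w8's observation; composition now `GoodLatticeBDPValueOfLambdaInequalityAnQ.goodLatticeBDPValue_of_pub_of_leTD_of_le_of_anQ`),
so that part (B) of the plumbing needs only «`corank Sel_nr ≤ corank R + p^c`» for `𝟙̃` (w8 `IndexPlumbingNrVsStrict`, landed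
modulo its local inputs) and not the reverse inequality. `stub_indexInputs` and the four other stubs are byte-identical to v20.

v20 (LEAD bsd-line-x1-p1 g4, 2026-08-28; v19.1 = 4a8c2afcfc681ae5): **THE PRE STUB `stub_imprimLambda` (KY Thm. 1.4.1 (iii),
the bare `λ`-identity) LEAVES THE SKELETON — its statement (cotorsion form) is DERIVED in the kernel glue
`imprimLambdaTD_of_index` along the V21 INDEX ROAD** (road memo `Lines/halves-imprimLambda-index-road.md`): the identity is
exact index bookkeeping — `λ(A) = ind(U(A)[p] → P_v̄(A)[p]) − dim U(A)/p` for the STRICT residual-type Selmer groups over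
`K_∞`, Kummer theory identifying `U(A)[p]`, `P(A)[p]` with residual cohomology, the residual long exact sequences over
`H = Gal(K̄/K_∞)` and over the `p^c` decomposition groups above `v̄`, KY's Cases I–III collapsing into ONE local
cancellation `#ker(i_*)·#ker(q_*) = p` (uniform in the number `p^c` of places above `v̄`, where the printed proof is
written for one place). The bookkeeping is LANDED, sorry-free, as seven helper files (`Theorems/EisensteinPrimesFiniteIndexSnake`,
`…FiniteIndexThree`, `…LambdaIdentityOfIndexInputs`, `…ResidualIndexKummer`, `…ResidualIndexUnramified`,
`…ResidualIndexModuleData`, `…ResidualIndexAssembly` — p642332, p642849, p643231, p643894, p644391, p645743, p645893), whose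
top is the MID-LEVEL COMPOSITION `ResidualIndexAssembly.zpCorank_datumStrictSelmer_add_eq`:
SUR ×3 + DIV ×3 + LRS + (U) + COT + `H⁰` facts + `H²` bookkeeping ⟹ `corank R(E[p^∞]) + ε = corank R((F/𝒪)(θsub)) +
corank R((F/𝒪)(θquot)) + p^c`. The two NEW stubs are KERNEL targets in `H¹`-language: `stub_indexInputs` (ONE existential
package: representatives `τ_i` of the places above `v̄`, the residual line `Φ` with its Kummer embeddings, and the 35 inputs of
the mid-level theorem at the data — SUR [PW11 A.2 / KY Prop. 1.3.2], DIV + LRS [`cd_p ≤ 1`], (U) [Néron–Ogg–Shafarevich],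
COT, `H⁰`, `H²` [weak Leopoldt + `cd_p ≤ 2`]) and `stub_indexPlumbing` (the mid-level conclusion ⟹ the `λ`-identity for the
dual data under the cotorsion facts: non-primitive vs strict at `v̄`, `λ = corank`, `Sel^{Sf}_{v̄}` = `R(E[p^∞])`). The
composition now goes through `GoodLatticeBDPValueOfLambdaIdentityTorsDAnQ.goodLatticeBDPValue_of_pub_of_lambdaTD_of_le_of_anQ`
(= p637183 with the identity required only under the cotorsion / `μ = 0` facts the composition holds at the point of use:
those of `𝔛^{Sf}_f` and [PWL-θ]'s `∀ D` clauses; both new stubs are KERNEL MODULO PUB — their antecedents name the eight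
Greenberg facts of stub 4 and Prop. 2.6.3 of stub 4b, supplied by the glue). Stubs (6): `stub_publishedFacts` (7 PUB, byte-identical) · `stub_indexInputs` (KERNEL) · `stub_indexPlumbing`
(KERNEL) · `stub_anThreeTrivial` (PRE, byte-identical) · `stub_publishedFactsGreenberg` (8 PUB, byte-identical) ·
`stub_publishedFactsMore` (4 PUB, byte-identical). The only PREPRINT residue left in the line is `stub_anThreeTrivial`
(KY Thm. 2.2.2 at `p = 3`, `𝟙̃|_{G_K} = 𝟙`). v19.1's description follows.

v19.1 (LEAD g3, 2026-08-28T13:5xZ): BOTH KERNEL AN STUBS OF v19 ARE CLOSED and leave the skeleton —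
`stub_katzLineIntFrameQ` (AN-F₁) landed p638281 (`GoodLatticeBDPValueAnQStubs.stub_katzLineIntFrameQ`, by
w2 gen 2's `KatzLineFrame.katzLineIntFrame_of_teichmullerPair`), `stub_katzLineDescentQ` (AN-F₂) landed p638329
(`KatzLineDescent.stub_katzLineDescentQ`, w3 gen 2, on w4 gen 2's rigidity files); the glue `anQ_of_pieces` calls
them by name. Stubs (5, NONE kernel): `stub_publishedFacts` (7 PUB) · `stub_imprimLambda` (PRE: KY Thm. 1.4.1
(iii)) · `stub_anThreeTrivial` (PRE: KY Thm. 2.2.2 at `p = 3`, `𝟙̃|_{G_K} = 𝟙`) · `stub_publishedFactsGreenberg`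
(8 PUB) · `stub_publishedFactsMore` (4 PUB/PUB-composed). v19's description follows.

v19 (LEAD bsd-line-x1-p1 g3, D-0154 row 4, 2026-08-28; v18 = 69f0b599b726dc03): **THE ANALYTIC STUB IS
RE-CUT IN THE ℚ-CURRENCY.** v14–v18's `stub_anDS : ∀ W p, GoodLatticeAnalyticSideDSOnTreeFree W p` ([AN]-DS-Free,
KY Thm. 2.2.2 read in the de Shalit frame, ONE preprint-labelled block) is REPLACED, following the ideator
supplement `Lines/halves_anDS_split_idea11g4.{lean,md}` rev 2 (bsd-idea-11 g4/g5, critic VERDICT #30 PASS) READ IN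
THE ℚ-CURRENCY OF THE WIDTH SEATS' LANDED ANALYTIC FILES (the residual pair quantified as a rational line `Φ`
with Teichmüller pair `(θsub, θquot)` over `ℚ` — `exists_teichmullerPair`, `isResidualPairOver_restrictField` —
and `θ_K` the Hecke character of `θquot|_{Γ_K}`, so that «`θ_K` has finite order, `θ_K ∘ c = θ_K`, unramified
above `p`» is a KERNEL fact, w2 gen 2's `KatzLineFrame.heckeCharOf_quotChar_finiteOrder_galConj_unramified`), by:
`stub_anThreeTrivial` (AN-3 = (d2): KY Thm. 2.2.2 at `p = 3`, `𝟙̃|_{G_K} = 𝟙` — the ONLY preprint residue of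
[AN], 1 303 / 1 487 census classes; K-currency, idea file VERBATIM) · `stub_katzLineIntFrameQ` (AN-F₁: the
`𝓞_{ℂ_p}`-valued CGLS-type frame of `θ_K` on the anticyclotomic line with first unit coefficient at
`ord(g(S=0) mod p)` — KERNEL; its header is `thmII64 →` the statement of w2 gen 2's LANDED
`KatzLineFrame.katzLineIntFrame_of_teichmullerPair` VERBATIM, so it closes by a three-line adapter) ·
`stub_katzLineDescentQ` (AN-F₂: λ-descent `𝓞_{ℂ_p}⟦T⟧ → R₀⟦T⟧`, `thm212 →` the ℚ-currency body of idea-11's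
`KatzLineDescentAt` — KERNEL target, size L, width seats w3/w4 gen 2) · the PUB slices of [AN]
(`thm222_…_of_five_le` PUB-composed, `thm222_…_of_ne_one` PUB, `thm212_exists_isKatzLFunction` PUB) joined with
Greenberg 2016 Prop. 2.6.3 in `stub_publishedFactsMore`; the kernel glue `thm222_OPEN_of_slices` + `anQ_of_pieces`
(idea-11 §2 in the ℚ-currency) assembles the ℚ-currency [AN]-DS-Free, consumed by the new composition
`GoodLatticeBDPValueOfLambdaIdentityAnQ.goodLatticeBDPValue_of_pub_of_lambda_of_le_of_anQ` (p637183 — a WEAKER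
analytic hypothesis than v18's, instantiated at restricted pairs only). v16's CLOSED kernel stub
`stub_fSideCorankLe` leaves the skeleton: the composition calls the landed `FSideCorankLe.stub_fSideCorankLe`
(p618030) by name. Stubs (7): `stub_publishedFacts` (7 PUB, byte-identical) · `stub_imprimLambda` (PRE, v18,
byte-identical) · `stub_anThreeTrivial` (PRE) · `stub_katzLineIntFrameQ` (KERNEL, closer in the tree) ·
`stub_katzLineDescentQ` (KERNEL, open) · `stub_publishedFactsGreenberg` (8 PUB, byte-identical) ·
`stub_publishedFactsMore` (4 PUB: prop263 + the three [AN] slices). v18's description follows.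

v18 (LEAD bsd-line-x1-p1 g3, D-0154 row 4, 2026-08-28; v17 = ce2ef040a96aca9e): **[ALG-imp] IS CUT DOWN
TO ITS BARE `λ`-IDENTITY.** Keller–Yin Thm. 1.4.1 (`thm141_imprimlambda_goodLattice_OPEN`, v17's
`stub_imprim`) has three conjuncts; its two STRUCTURAL conjuncts «`𝔛^{Sf}_f` and `𝔛_f` are finitely
generated `Λ`-torsion with `μ`-invariants `0`» are now the KERNEL theorem
`Thm141TorsionClauses.moduleFinite_isTorsion_muInvariant_eq_zero_of_forall_dualData` (LEAD g3 files
`…CharResidualSelmerFinite` p634599 — Pontryagin for Greenberg–Vatsal dual data + Kummer injectivity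
`H¹(H, 𝔽(θ̄)) ↪ H¹(H, (F/𝒪)(θ))` for every `H ≤ Γ_K`; `…ResidualPairStableLine` p635113 — the residual pair
as a `StableSubgroup` line with equivariant socle embeddings; `…Thm141TorsionClauses` — the residual
dévissage along `0 → 𝔽(ω̃) → E_K[p] → 𝔽(𝟙̃) → 0` WITHOUT the non-anomalous clause (x2-p2 p628626) +
Brink + Néron–Ogg–Shafarevich + Greenberg's criterion (A)), fed by the FIRST CLAUSE of [PWL-θ]
(`prop125_residualPair_unrSelmer_imprimitive`, kernel modulo PUB since v17). So the new stub
`stub_imprimLambda` is the LAST conjunct of Thm. 1.4.1 ALONE — binders VERBATIM those of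
`thm141_imprimlambda_goodLattice_OPEN`, conclusion `λ(𝔛^{Sf}_f) + [𝟙̃|_{G_K} = 𝟙] = λ(𝔛^{Sf}_ω̃) + λ(𝔛^{Sf}_𝟙̃)`
— the located GAP line (⋆) A7 itself, one numerical identity (PRE; a WEAKENING of v17's stub, so nothing
PRE-new is introduced); the composition goes through
`GoodLatticeBDPValueOfLambdaIdentity.goodLatticeBDPValue_of_pub_of_lambda_of_le`. Stubs (6):
`stub_publishedFacts` (7 PUB) · `stub_imprimLambda` (PRE, ONE identity) · `stub_fSideCorankLe` (KERNEL —
CLOSED, p618030) · `stub_anDS` (PRE) · `stub_publishedFactsGreenberg` (8 PUB) · `stub_publishedFactGreenberg263`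
(1 PUB); every other stub is byte-identical to v17. v17's description follows.

v17 (LEAD bsd-line-x1-p1 g2, D-0154 row 4, 2026-08-28; v16 = bae7b7be6f764cf8): **[PWL-θ] IS KERNEL.** The
PUB-composed stub `stub_imprimCorank : prop125_residualPair_unrSelmer_corank_ge` (Pollack–Weston 2011 Prop. A.2 ∘
KY/CGLS Lemma 1.1.1) is DELETED: it is now the tree theorem
`AcTwistDeformation.prop125_residualPair_unrSelmer_corank_ge_of_facts` (road (A) of the LEAD verdict v3.1 §3:
Greenberg 2016 Prop. 2.6.3 `SUR ⇐ LEO + CRK` for the ONE-variable twist deformation `𝐃₁(θ) = ℚ_p/ℤ_p(θ) ⊗ Λ^*(κ⁻¹)`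
— cofree, LEO by the corank squeeze, LOC⁽¹⁾, CRK (LEAD g2 files `…AcTwistDeformation{Cofree,LEO,SUR}`), Shapiro's
lemma in both directions (`…{Shapiro,Cotorsion,LocalShapiro,LocalClasses,LocSurj}`), the residual-pair instantiation
(width seat w3 `…AcTwistDeformationResidualPair`: Néron–Ogg–Shafarevich, Brink, [RH] transport), the per-place lower
bound and the corank bookkeeping (width seat w2 `…CharLocalTame{Count,Corank}`, `…CharLocalTorsionBound`,
`…UnrSelmerQuotientCorankGeOfSurjective`, `…UnrSelmerNaturalLocalization`)), CONDITIONAL only on published facts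
by name. Its one new by-name input, Greenberg 2016 Prop. 2.6.3 (`Greenberg2016.prop263_sur_of_crk`, PUB), is the NEW
fact-grade stub `stub_publishedFactGreenberg263` (one statement; `stub_publishedFactsGreenberg` is kept
BYTE-IDENTICAL so that nothing registered moves); Greenberg 2006 Props. 4.1/4.2/3.2/§5 A are read off
`stub_publishedFactsGreenberg` as before. Stubs (6): `stub_publishedFacts` (7 PUB) · `stub_imprim` (PRE) ·
`stub_fSideCorankLe` (KERNEL — CLOSED, p618030) · `stub_anDS` (PRE) · `stub_publishedFactsGreenberg` (8 PUB) ·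
`stub_publishedFactGreenberg263` (1 PUB). Every other line of v16 is byte-identical. v16's description follows.

v16 (LEAD successor bsd-line-x1-p1-g0, D-0154 row 4, 2026-08-28; v15 = d2b7a17cbe78f12e): the ONE-INEQUALITY
road. The `f`-side `S`-relaxation identity [PWL-f] `rem142_goodLattice_selmerAc_imprimitive` (PUB-composed:
Pollack–Weston A.2 ∘ CGLS L893–931) is NO LONGER AN INPUT: its `≥` half is never needed, because the published
one-sided divisibility L-div (CGLS Thm. 4.1.2 / Prop. 4.2.1, `GoodLatticeDivOnTree`, inside `stub_publishedFacts`)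
already bounds `λ(𝔛_f) ≤ λ(𝓛_f)`, and the Eisenstein bookkeeping needs the `f`-side corank only bounded
ABOVE (`Theorems/EisensteinPrimesGoodLatticeBDPValueOfOneInequality.lean`: `le_of_C_pow_mul_mem`,
`thm151ConclusionLE_of_thm141_at`, `goodLatticeMuLambdaOnTree_of_div_of_le_of_facts`,
`goodLatticeBDPValue_of_pub_of_imprimitive_of_le`). So `stub_imprimCorank` is now the character-side `≥` half
ALONE, and the `f`-side `≤` half is the NEW KERNEL STUB `stub_fSideCorankLe` (binders of `rem142_…` verbatim,
conclusion `zpCorank (Sel_v̄^{Sf}/Sel_v̄^∅) ≤ Σ curveLocalLambda`; per place: additive p612280, split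
multiplicative p613424, non-split p614431, Tate uniformisations PROVED in `TateCurve/NumberFieldUniformization*`;
assembly in the lane of seat bsd-line-x1-p1-w2, RULING L110). Stubs (6): `stub_publishedFacts` (7 PUB) ·
`stub_imprim` (PRE) · `stub_imprimCorank` (PUB-composed, ONE statement) · `stub_fSideCorankLe` (KERNEL, open) ·
`stub_anDS` (PRE) · `stub_publishedFactsGreenberg` (8 PUB); stubs 1, 2a, 3, 4 byte-identical to v14/v15.

v15 (LEAD bsd-line-x1-p1, D-0154 row 4, 2026-08-28, RULING L108; v14 = 440b763ce3f445f3): `stub_imprimCorank`'s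
character conjunct is now ONLY the `≥` HALF `prop125_residualPair_unrSelmer_corank_ge` (Literature/NumberTheory/
EllipticCurves/AnticyclotomicSRelaxationCorankGe.lean, p611956: Pollack–Weston A.2 surjectivity ∘ Lemma 1.1.1 read for
the one inequality that is not kernel) — the `≤` half is the KERNEL theorem
`UnrSelmerQuotientCorankLocalLambda.zpCorank_unrSelmer_quotient_le_at_residualPair` (p611233; this wave: LEAD p607392 /
p607486 / p607434 / p607760 + width seat -w2 p608097 / p609213: the quotient embeds in `∏_{w∈Sf} ∏_{η∣w} H¹(I_η,
(F/𝒪)(θ))`, each factor of corank `≤ 𝟙[θ(Frob_w) ≡ Nw]`), and the equality is recovered by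
`GoodLatticeCorankOfGe.prop125_corank_of_ge` (p611963) before `prop125_quotient_of_corank`. Every other stub is
BYTE-IDENTICAL to v14. v14's description follows.

v14 (registrar bsd-eis-k5-c2 g11, 2026-08-28; v13 = 53260fc2a0bdaa87 with the QUOTIENT form; v12 =
c7240cd4bd4cda97 with the STRONG form; v11 = b776d0d240d6f726): `stub_imprimCorank`'s character conjunct
is the BARE CORANK identity `prop125_residualPair_unrSelmer_corank`
("`corank_{ℤ_p}(H¹_{𝓕_nr^{Sf}}/H¹_{𝓕_nr}) = Σ λ𝒫_w(θ)`" — Pollack–Weston A.2 surjectivity + the local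
`λ`-values of Lemma 1.1.1, nothing structural); the finiteness of the quotient's `p`-torsion
(`UnrSelmerQuotientTorsionFiniteChar`, p574445: divisible character module, split primes finitely
decomposed by Brink 2007, Kummer + Milne I.2.9) and the first clause of Prop. 1.2.5
(`UnrSelmerImprimitiveFiniteness`, p569470) are KERNEL, chained by
`GoodLatticeQuotientOfCorank.prop125_quotient_of_corank` and
`GoodLatticeImprimitiveOfQuotient.prop125_imprimitive_of_quotient`; and `stub_rubinHida`
(`thm122_rubinHida_residualPair_unrSelmer`, the Rubin–Hida cotorsion of the character Selmer duals)
is DROPPED — the line's own two-variable road (`goodLattice_jointMuLambda_of_facts`: Bleher et al. 2020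
Thm. 3.3.1, de Shalit II.6.4, Hida Thm. I, Rubin 5.3 (v) `h_K`-free = `noPseudoNull_of_pub` on stub 4)
already proves it in the kernel at the point where [ALG] is consumed, and the composition now runs
through `GoodLatticeBDPValueOfImprimitive.goodLatticeBDPValue_of_pub_of_imprimitive`
(`Theorems/EisensteinPrimesGoodLatticeBDPValueOfImprimitive.lean`), which takes [ALG-imp] + [PWL-θ] +
[PWL-f] in place of [ALG]. Stubs (5, NO kernel stub): `stub_publishedFacts` (7 PUB) · `stub_imprim`
(`thm141_imprimlambda_goodLattice_OPEN` = KY Thm. 1.4.1 = the located GAP line (⋆) A7; PRE) ·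
`stub_imprimCorank` (`prop125_…_corank ∧ rem142_…`: Pollack–Weston 2011 A.2 ∘ Lemma 1.1.1 /
CGLS L893–901, the two bare `S`-relaxation corank identities; PUB-composed — reviewer rules) · `stub_anDS` (PRE) ·
`stub_publishedFactsGreenberg` (8 PUB). PREPRINT atoms of the crux: KY Thm. 1.4.1 and KY Thm. 2.2.2 in
the DS frame; everything else is published print or kernel.

Route `EisensteinPrimes` (rung K5), crux rank 2 = row A1 of the FULL-BSD rank-≤1 programme (class X1
type A, analytic rank 1): `GoodLatticeBDPValue := KellerYin2024.thm308_imc2_bdpValue_goodLattice_OPEN`.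
History: v1/v2 (ky g6), v3 (k5-c2 g2), v4 (g6), v5 (g7), v6–v9 (g9), v10 (g10: assembled, no kernel
stub), v11 (g11: (B0), `stub_alg` ↦ imprim + rubinHida + imprimCorank), v12/v13/v14 (g11: rubinHida discharged by the road; [PWL-θ] in
quotient, then bare-corank form). HOME/k5-c2-MEMO-1…11, HOME/k5-c2-g11/GoodLatticeBDPValue.v11.lean.
-/

-- `Summit.BirchSwinnertonDyer.BirchSwinnertonDyer.…`: the summit and its single sub-problem share a name (D-0017 layout).
set_option linter.dupNamespace false
set_option autoImplicit false

namespace Summit.BirchSwinnertonDyer.BirchSwinnertonDyer.Cruxes.GoodLatticeBDPValue.Halves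

open Literature.NumberTheory.EllipticCurves.CastellaGrossiLeeSkinner2022 Literature.NumberTheory.EllipticCurves.BCGKPST2020
  Literature.NumberTheory.EllipticCurves.DeShalit1987 Literature.NumberTheory.EllipticCurves.KellerYin2024
  Literature.NumberTheory.EllipticCurves.Hida2010MuInvariant

/-- **CITE STUB `stub_printInputs` [CITE-ONLY — never a proof target, never benched] (director-bsd (390) VARIANT-N; v33N)**: ALL print
facts the line reads BY NAME, as ONE conjunction — (a) the four BDP/CM-side research facts of v32's stub 1 (CGLS 2022 proof of Thm. 4.2.2 first half,
CGLS 2022 Thm. 5.1.3 under (disc), Bleher et al. 2020 Thm. 3.3.1, de Shalit 1987 II.6.4 Thm. (i)); (b) CGLS 2022 Thm. 2.1.2 (`thm212_exists_isKatzLFunction`,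
v32's stub 4b conjunct 2).  Milne ADT I 4.10 (a), Milne I 5.1, Harari 17.13 (a), Greenberg 2016 2.6.3 (c) and 4.1.1 (at the line's instance), Greenberg 2006
3.2/4.1/4.2/§5 A, NSW (10.3.25) are TREE THEOREMS fed by the closure.  The FIVE Literature decls carried, by name:
`CastellaGrossiLeeSkinner2022.proofThm422_exists_isBDPLFunction_isTorsion_charIdeal_dvd`, `CastellaGrossiLeeSkinner2022.thm513_exists_isBDPLFunction_valueAtOne_disc`,
`BCGKPST2020.thm331_rubin_exists_katzMeasure₂_pseudoIso_span_eq`, `DeShalit1987.thmII64_katzMeasure₂_functionalEquation`, `CastellaGrossiLeeSkinner2022.thm212_exists_isKatzLFunction`.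
[cite: CastellaGrossiLeeSkinner2022, proof of Thm. 4.2.2 (Thm. 4.1.2, Rem. 4.1.3, Prop. 4.2.1) and Thm. 5.1.3 with §2 (disc) (TeX L935)] [cite: BertoliniDarmonPrasanna2013, Thm. 5.13 with Assumption 5.12 (3)] [cite: BleherEtAl2020, §3.3 Thm. 3.3.1] [cite: deShalit1987, II.6.4 Theorem (i)]
[cite: CastellaGrossiLeeSkinner2022, Thm. 2.1.2] -/
theorem stub_printInputs :
    (proofThm422_exists_isBDPLFunction_isTorsion_charIdeal_dvd ∧
      thm513_exists_isBDPLFunction_valueAtOne_disc ∧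
      thm331_rubin_exists_katzMeasure₂_pseudoIso_span_eq ∧
      thmII64_katzMeasure₂_functionalEquation) ∧
    thm212_exists_isKatzLFunction := by
  sorry

/-- **CITE STUB `stub_descentInputs` [CITE-ONLY — never a proof target, never benched] (v34N)**: the two PUBLISHED named facts from which the former
content stub 3a-A (`KellerYin2024.thm222_anacong_goodLattice_of_fullDescentDatum`, v24–v33N) is now a TREE THEOREM
(`GoodLatticeAnacongOfCGLSProofOfDatum.thm222_anacong_goodLattice_of_fullDescentDatum_of_proofThm221_of_thmI`, width seat -w2 gen 26, p761499):
`CastellaGrossiLeeSkinner2022.proofThm221_congruence_of_fullEisensteinDescent` — Castella–Grossi–Lee–Skinner 2022 (Invent. Math. 227), the PROOF of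
Thm. 2.2.1 from the Eisenstein congruence (eq:cong-mf) with (eq:cong-mf) entered through Kriz 2016 Def. 31 / Rem. 32 full descent of type
`(φ̃, φ̃⁻¹, N₊, N₋, N₀)` (Literature p759553, accepted by review; weaker than print by design) — and `Hida2010MuInvariant.thmI_mu_katzLFunction_eq_zero` —
Hida 2010 (Ann. of Math. 172) Thm. I, the vanishing of the `μ`-invariant of the anticyclotomic Katz `p`-adic `L`-function.  Two Literature decls by name;
read by the composition through `…V34.goodLatticeBDPValue_of_namedFacts₃₄`.
[cite: CastellaGrossiLeeSkinner2022, Thm. 2.2.1 and proof of Thm. 2.2.2 (arXiv:2008.02571v2 TeX L1051–1153)] [cite: Kriz2016, Def. 31, Rem. 32, Rem. 33, Thm. 34 (2)–(3), Thm. 35]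
[cite: Hida2010MuInvariant, Thm. I (p. 45)] -/
theorem stub_descentInputs :
    proofThm221_congruence_of_fullEisensteinDescent ∧ thmI_mu_katzLFunction_eq_zero := by
  sorry

/-- **THE COMPOSITION (v34N, thin): the crux BY NAME from the two CITE stubs** — ONE call to width seat -w2 gen 27's kernel-checked by-name closure
`GoodLatticeBDPValueOfNamedFactsV34.goodLatticeBDPValue_of_namedFacts₃₄` (p763736) = LEAD g11's `…V33N.goodLatticeBDPValue_of_namedFacts₃₃ₙ` (v33N's composition body,
token for token: `…V33P.goodLatticeBDPValue_of_namedFacts₃₃ₚ` fed the Poitou–Tate THEOREM `PoitouTateShaNaturalAtTC.forall_poitouTate_shaRestricted_tateDual_natural_at_of_isTotallyComplex`)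
with its content hypothesis 3a-A supplied by -w2 gen 26's `GoodLatticeAnacongOfCGLSProofOfDatum.thm222_anacong_goodLattice_of_fullDescentDatum_of_proofThm221_of_thmI stub_descentInputs.1 stub_descentInputs.2`.
[cite: KellerYin2024, Thm. 3.0.8 (IMC2) — statement shape] [cite: CastellaGrossiLeeSkinner2022, Thm. 2.2.1, proof of Thm. 4.2.2, Thm. 5.1.3, Thm. 2.1.2] [cite: Hida2010MuInvariant, Thm. I]
[cite: MilneADT2006, I Thm. 4.10 (a), I Thm. 5.1] [cite: Greenberg2016Selmer, Prop. 2.6.3 (c), Prop. 4.1.1] -/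
theorem GoodLatticeBDPValue_of :
    Summit.BirchSwinnertonDyer.BirchSwinnertonDyer.Theses.EisensteinPrimes.GoodLatticeBDPValue :=
  Summit.BirchSwinnertonDyer.BirchSwinnertonDyer.Theorems.GoodLatticeBDPValueOfNamedFactsV34.goodLatticeBDPValue_of_namedFacts₃₄
    stub_printInputs stub_descentInputs.1 stub_descentInputs.2

end Summit.BirchSwinnertonDyer.BirchSwinnertonDyer.Cruxes.GoodLatticeBDPValue.Halves
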